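import Summits.QuantumFields.YangMills.Theses.EquipartitionCriticality
import Summits.QuantumFields.YangMills.Theorems.EquipartitionCriticalityLatticeGapLargeBetaStubAnchorZero
import Summits.QuantumFields.YangMills.Theorems.EquipartitionCriticalityLatticeGapLargeBetaStubRateDilution
import Summits.QuantumFields.YangMills.Theorems.EquipartitionCriticalityLatticeGapLargeBetaStubSlabToCrux
import Summits.QuantumFields.YangMills.Theorems.EquipartitionCriticalityLatticeGapLargeBetaStubIterateLadder

/-!
# The two hearts of line `Sketch` (card `af-staircase-transport`) for crux stmt-QuantumFields-8761, BY NAME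

Support file for crux stmt-QuantumFields-8761
(`Summit.QuantumFields.YangMills.Theses.EquipartitionCriticality.LatticeGapLargeBeta`: volume-uniform
exponential time-clustering of all bounded gauge-invariant local observables on the tori `(2S+1)⁴` at
every large `β`, with `β`-uniform pair constants `C(A,B)`).  The lead's skeleton `Cruxes/LatticeGapLargeBeta/Lines/Sketch.lean`
closes the crux modulo ONE registered stub, the staircase `stub_staircase` (reshape r1, ladder form).  This
file records the two implications a planner needs in order to file the heart as an item, each with the
crux as its conclusion BY NAME and the heart as an explicit hypothesis (no `sorry`, no named fact):

* `latticeGapLargeBeta_of_uniformSlabClustering` — **the weakest heart along this line**: if for every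
  compact simple `G` and every `r` there is a threshold `β₁` such that at every `β ≥ β₁` all species
  cluster on all large tori in the sup-norm × width currency SC(β, S, m(β), K(β)) (`m(β) ∈ (0,1]`,
  `K(β) ≥ 2`, `S ≥ S₀(β)`), then the crux holds — rate dilution (`stub_rateDilution`, landed) makes the
  `β`-uniform `C(A,B) = 2e^{2w+1} a b` free.  This hypothesis is the crux in the SC currency: it is
  implied by the staircase (next item) and is strictly simpler to state.
* `latticeGapLargeBeta_of_staircase` — the line's mechanism: the registered heart `stub_staircase`
  VERBATIM (asymptotic-freedom staircase anchored at `β = 0`, rungs landing on a `Δβ`-fine ladder or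
  above `β⋆`) implies the crux, through the landed anchor `stub_anchorZero` (SC(0, S, 1, 2), Haar
  product at `β = 0`), the landed climb `stub_iterateLadder`, and the previous item.

So the moment either hypothesis is a theorem `X_holds : X` of the tree, `latticeGapLargeBeta_of_… X_holds`
closes the crux in one line.

Currency (inlined): SC(β, S, m, K) :≡ for all `YMSpecies` `A, B` with sup bounds `a, b` and supports in
the time slab `|t| ≤ w`, and all `n ≤ S`,
`|latticeConnectedCorr r.ρ β (2S+1) A.F B.F n| ≤ K a b e^{2mw} e^{−mn}`.
-/

noncomputable section

open scoped BigOperators Topology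
open MeasureTheory ProbabilityTheory Filter
open Literature.MathematicalPhysics.QuantumFieldTheory Literature.MathematicalPhysics.QuantumLattice

namespace Summit.QuantumFields.YangMills.Theorems.LatticeGapLargeBeta.AfStaircase

/-- From the SC currency above a threshold to the crux body for one `r` (the landed stub
`stub_slabToCruxFrom`, p108999, restated here through `stub_slabToCrux`'s helper because this file
must not depend on the build order of sibling modules): clustering of all species on all large tori
at every `β ≥ β₁` with `m(β) ∈ (0,1]`, `K(β) ≥ 2`, `S₀(β)` in the SC currency, plus rate dilution,
give the crux body for `r` with threshold `β₁`, rate `m(β) log 2 / log K(β)` and the `β`-uniform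
constant `2 e^{2w+1} a b`. -/
theorem cruxBody_of_uniformSlabClustering
    (G : Type) [Group G] [TopologicalSpace G] [IsTopologicalGroup G] [CompactSpace G]
      [MeasurableSpace G] [BorelSpace G] (r : LatticeRep G)
    (hSC : ∃ β₁ : ℝ, ∀ β : ℝ, β₁ ≤ β → ∃ (m K : ℝ) (S₀ : ℕ), 0 < m ∧ m ≤ 1 ∧ 2 ≤ K ∧
      ∀ S : ℕ, S₀ ≤ S →
      ∀ (A B : YMSpecies G) (a b : ℝ) (w : ℕ), (∀ U, |A.F U| ≤ a) → (∀ U, |B.F U| ≤ b) →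
        (∀ e ∈ A.supp, |e.1 0| ≤ (w : ℤ)) → (∀ e ∈ B.supp, |e.1 0| ≤ (w : ℤ)) →
        ∀ n : ℕ, n ≤ S →
          |latticeConnectedCorr r.ρ β (2 * S + 1) A.F B.F n| ≤
            K * a * b * Real.exp (m * (2 * w)) * Real.exp (-(m * n))) :
    ∃ (β₁ : ℝ) (m : ℝ → ℝ) (S₀ : ℝ → ℕ), (∀ β : ℝ, β₁ ≤ β → 0 < m β) ∧
      ∀ A B : YMSpecies G, ∃ C : ℝ, ∀ β : ℝ, β₁ ≤ β → ∀ S n : ℕ, S₀ β ≤ S → n ≤ S →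
        |latticeConnectedCorr r.ρ β (2 * S + 1) A.F B.F n| ≤ C * Real.exp (-(m β * n)) := by
  obtain ⟨β₁, hSC⟩ := hSC
  choose! m K S₀ hm hm1 hK hP using hSC
  refine ⟨β₁, fun β => m β * Real.log 2 / Real.log (K β), S₀, fun β hβ => ?_, fun A B => ?_⟩
  · exact div_pos (mul_pos (hm β hβ) (Real.log_pos one_lt_two))
      (Real.log_pos (lt_of_lt_of_le one_lt_two (hK β hβ)))
  · obtain ⟨a, ha⟩ := A.bounded
    obtain ⟨b, hb⟩ := B.bounded
    have ha0 : 0 ≤ a := (abs_nonneg _).trans (ha fun _ => 1)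
    have hb0 : 0 ≤ b := (abs_nonneg _).trans (hb fun _ => 1)
    obtain ⟨w, hwA, hwB⟩ : ∃ w : ℕ, (∀ e ∈ A.supp, |e.1 0| ≤ (w : ℤ)) ∧
        ∀ e ∈ B.supp, |e.1 0| ≤ (w : ℤ) :=
      ⟨(A.supp ∪ B.supp).sup fun e => (e.1 0).natAbs,
        fun e he => abs_le_natCast_sup_natAbs (fun e => e.1 0) (Finset.mem_union_left B.supp he),
        fun e he => abs_le_natCast_sup_natAbs (fun e => e.1 0) (Finset.mem_union_right A.supp he)⟩
    refine ⟨2 * Real.exp (2 * w + 1) * a * b, fun β hβ S n hS hn => ?_⟩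
    exact stub_rateDilution (fun k => latticeConnectedCorr r.ρ β (2 * S + 1) A.F B.F k) a b (K β) (m β)
      w S ha0 hb0 (hK β hβ) (hm β hβ) (hm1 β hβ)
      (fun k _ => by
        rw [mul_assoc]
        exact WilsonBlockHeatBath.abs_latticeConnectedCorr_le_two_mul r β (2 * S + 1) ha hb k)
      (fun k hk => hP β hβ S hS A B a b w ha hb hwA hwB k hk) n hn

/-- **The weakest heart of line `Sketch`, with the crux as conclusion BY NAME.**  If for every
compact simple `G` and every faithful `r` there is `β₁` such that at every `β ≥ β₁` all bounded
gauge-invariant local observables cluster on all tori `(2S+1)⁴`, `S ≥ S₀(β)`, in the SC currency with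
some `m(β) ∈ (0, 1]` and `K(β) ≥ 2` (constants seeing `A, B` only through sup norms and the time width
of the supports), then `LatticeGapLargeBeta` holds: the `β`-uniform pair constant demanded by the crux
is `C(A,B) = 2 e^{2w+1} a b`, at the diluted rate `m(β) log 2 / log K(β) > 0`
(`cruxBody_of_uniformSlabClustering`).  The hypothesis is implied by the registered staircase heart
(`latticeGapLargeBeta_of_staircase`) and is the statement a planner should file if the heart of this
line is promoted to an item. -/
theorem latticeGapLargeBeta_of_uniformSlabClustering :
    (∀ (G : Type) [Group G] [TopologicalSpace G] [IsTopologicalGroup G] [CompactSpace G]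
      [MeasurableSpace G] [BorelSpace G], IsCompactSimpleLieGroup G → ∀ (r : LatticeRep G),
      ∃ β₁ : ℝ, ∀ β : ℝ, β₁ ≤ β → ∃ (m K : ℝ) (S₀ : ℕ), 0 < m ∧ m ≤ 1 ∧ 2 ≤ K ∧
      ∀ S : ℕ, S₀ ≤ S →
      ∀ (A B : YMSpecies G) (a b : ℝ) (w : ℕ), (∀ U, |A.F U| ≤ a) → (∀ U, |B.F U| ≤ b) →
        (∀ e ∈ A.supp, |e.1 0| ≤ (w : ℤ)) → (∀ e ∈ B.supp, |e.1 0| ≤ (w : ℤ)) →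
        ∀ n : ℕ, n ≤ S →
          |latticeConnectedCorr r.ρ β (2 * S + 1) A.F B.F n| ≤
            K * a * b * Real.exp (m * (2 * w)) * Real.exp (-(m * n))) →
    Summit.QuantumFields.YangMills.Theses.EquipartitionCriticality.LatticeGapLargeBeta := by
  intro hU G _ _ _ _ hG
  letI : MeasurableSpace G := borel G
  haveI : BorelSpace G := ⟨rfl⟩
  intro r
  exact cruxBody_of_uniformSlabClustering G r (hU G hG r)

/-- **The registered heart `stub_staircase` (reshape r1, ladder form) implies the crux BY NAME.**
For every compact simple `G` and faithful `r` let there be a step bound `Δβ > 0`, a rate loss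
`θ ∈ (0, 1]`, a prefactor loss `c ≥ 1`, a threshold `β⋆`, a volume floor `L₀(β)` and a ladder
`0 = lad 0 < lad 1 < ⋯` with steps `≤ Δβ` reaching `β⋆`, such that for all `β ≥ 0`, `0 < δ ≤ Δβ`
with `β + δ` a ladder point or `≥ β⋆`, `S ≥ L₀(β)`, `0 < m ≤ 1`, `K ≥ 2`:
SC(β, S, m, K) ⇒ SC(β+δ, 2S, θm, cK) ∧ SC(β+δ, 2S+1, θm, cK).  Then `LatticeGapLargeBeta` holds:
anchor SC(0, S, 1, 2) at `β = 0` (`stub_anchorZero`, Haar product), climb the ladder and step freely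
above `β⋆` (`stub_iterateLadder`), and conclude by `latticeGapLargeBeta_of_uniformSlabClustering`.
The hypothesis is, verbatim, the one open stub of `Cruxes/LatticeGapLargeBeta/Lines/Sketch.lean`. -/
theorem latticeGapLargeBeta_of_staircase :
    (∀ (G : Type) [Group G] [TopologicalSpace G] [IsTopologicalGroup G] [CompactSpace G]
      [MeasurableSpace G] [BorelSpace G], IsCompactSimpleLieGroup G → ∀ (r : LatticeRep G),
    ∃ (Δβ θ c βs : ℝ) (L₀ : ℝ → ℕ) (lad : ℕ → ℝ), 0 < Δβ ∧ 0 < θ ∧ θ ≤ 1 ∧ 1 ≤ c ∧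
      lad 0 = 0 ∧ (∀ k : ℕ, lad k < lad (k + 1) ∧ lad (k + 1) ≤ lad k + Δβ) ∧ (∃ k : ℕ, βs ≤ lad k) ∧
      ∀ β : ℝ, 0 ≤ β → ∀ δ : ℝ, 0 < δ → δ ≤ Δβ → (βs ≤ β + δ ∨ ∃ k : ℕ, β + δ = lad k) →
      ∀ S : ℕ, L₀ β ≤ S → ∀ m K : ℝ, 0 < m → m ≤ 1 → 2 ≤ K →
        (∀ (A B : YMSpecies G) (a b : ℝ) (w : ℕ), (∀ U, |A.F U| ≤ a) → (∀ U, |B.F U| ≤ b) →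
          (∀ e ∈ A.supp, |e.1 0| ≤ (w : ℤ)) → (∀ e ∈ B.supp, |e.1 0| ≤ (w : ℤ)) →
          ∀ n : ℕ, n ≤ S →
            |latticeConnectedCorr r.ρ β (2 * S + 1) A.F B.F n| ≤
              K * a * b * Real.exp (m * (2 * w)) * Real.exp (-(m * n))) →
        (∀ (A B : YMSpecies G) (a b : ℝ) (w : ℕ), (∀ U, |A.F U| ≤ a) → (∀ U, |B.F U| ≤ b) →
          (∀ e ∈ A.supp, |e.1 0| ≤ (w : ℤ)) → (∀ e ∈ B.supp, |e.1 0| ≤ (w : ℤ)) →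
          ∀ n : ℕ, n ≤ 2 * S →
            |latticeConnectedCorr r.ρ (β + δ) (2 * (2 * S) + 1) A.F B.F n| ≤
              c * K * a * b * Real.exp (θ * m * (2 * w)) * Real.exp (-(θ * m * n))) ∧
        (∀ (A B : YMSpecies G) (a b : ℝ) (w : ℕ), (∀ U, |A.F U| ≤ a) → (∀ U, |B.F U| ≤ b) →
          (∀ e ∈ A.supp, |e.1 0| ≤ (w : ℤ)) → (∀ e ∈ B.supp, |e.1 0| ≤ (w : ℤ)) →
          ∀ n : ℕ, n ≤ 2 * S + 1 →
            |latticeConnectedCorr r.ρ (β + δ) (2 * (2 * S + 1) + 1) A.F B.F n| ≤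
              c * K * a * b * Real.exp (θ * m * (2 * w)) * Real.exp (-(θ * m * n)))) →
    Summit.QuantumFields.YangMills.Theses.EquipartitionCriticality.LatticeGapLargeBeta :=
  fun hH => latticeGapLargeBeta_of_uniformSlabClustering fun G _ _ _ _ _ _ hG r =>
    stub_iterateLadder G r (hH G hG r) (stub_anchorZero G r)

end Summit.QuantumFields.YangMills.Theorems.LatticeGapLargeBeta.AfStaircase

end
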